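/-
COR-CM (cell pub-hodgecm2) — desk lemma of seat pub-hodgecm2-rekey-l0-instlevel-b gen 2, 2026-08-24.  THEOREMS ONLY; nothing landed is edited
or restated.  Gap (β) of cite-1's HHOM-(ii) (HOME/INBOX l.13589) in kernel dress: the index OF RECORD `I V (repAt a₀) (muLiu ι₁ GramClass.rep)`
([Liu21, Def. 4.12]'s «non-empty index» at the pinned dictionary of record) IS INHABITED — over every Gram class, and over the class of the
pointing scalar `a₀` by Liu's weight-one line `ι_{μ₀}` itself — under E's `hemb : (mk ι₁).embedding = ι₁` (the face's `hV`).
HC_CM is NOT proved; «Δ2 BRIDGE CLOSED» is NOT claimed; nothing here inhabits `hLiu ∕ hLiuC ∕ hM`.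
-/
import Summits.HodgeConjecture.CorCM.B01.Transposition.Item6CentralTypeAtPinIndex
import Summits.HodgeConjecture.HodgeCM.Model.LiuDictionaryPinEq
import Literature.NumberTheory.Automorphic.ConjugateSelfDualCharacters
import HarnessLib

/-!
# The index of record is non-empty ([Liu21, Def. 4.12]: `𝔈(μ) ≠ ∅` at every global line class)

At the pinned dictionary of record (`ρ := LiuIndex.repAt a₀`, recipe `μ := LiuIndex.muLiu ι₁ GramClass.rep`) the index type
`I V (repAt a₀) (muLiu ι₁ GramClass.rep) = Σ q, {s : SplittingAt V (repAt a₀ q) // compatible ∧ central type muLiu ⟦·⟧}` has an element over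
EVERY Gram class `q`: take a conjugate-symplectic WEIGHT-ONE idele class character `μ₀` of CM type `Φ^δ(repAt a₀ q)` ([WeilBNT1967, Ch. VII §3],
tree `IdeleClassGroup.exists_isConjugateSymplectic_hasCMType`) and pin-3's pointed constructor at a character
(`CentralTypeAtPin.exists_line_eq_ofCM_chiSplittingLine_toHeckeCharacter`): the line `ι_{toHecke μ₀}` at that scalar is an index line.
Over the class of `a₀` the scalar is `a₀` itself (`repAt_mk_self`).  KERNEL only; E's `hemb` is the one hypothesis.
-/

set_option autoImplicit false

noncomputable section

namespace Summit.HodgeConjecture.CorCM.Transposition.CentralTypeAtPin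

open NumberField NumberField.InfinitePlace
open Literature.NumberTheory.Automorphic Literature.NumberTheory.Automorphic.IdeleClassGroup
open Literature.NumberTheory.Automorphic.Liu2021.Def411WeilCarriersDoubling
open Literature.NumberTheory.GelbartRogawski1991 Literature.NumberTheory.GelbartRogawski1991.UnitaryDualPair
open Literature.NumberTheory.GelbartRogawski1991.GRConstruction
open Literature.NumberTheory.GaloisRepresentations
open HodgeCM HodgeCM.Model HodgeCM.Model.LiuIndex
open HodgeCM.SignRecipe (lineType)
open HodgeCM.Model.ArchSideTerm (e₁)

variable {L : CMField} {ι₁ : (L : Type) →+* ℂ} (V : HermSpace3 L ι₁) (a₀ : RealScalar L)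

/-- **every Gram class carries an index line of the pinned dictionary of record** ([Liu21, Def. 4.12]: for every global line `ε` the
index `(ε, χ)` is non-empty — here at the recipe of record, under E's `hemb`): over `q` sits Liu's `ι_{μ₀}` at the scalar `repAt a₀ q`
for any conjugate-symplectic weight-one `μ₀` with `Φ_{μ₀} = Φ^δ(repAt a₀ q)`, which exists by [WeilBNT1967, Ch. VII §3].
[cite: Liu2021, Def. 4.3 and Def. 4.12 (FJcycle.tex l. 2102–2111)] [cite: WeilBNT1967, Ch. VII §3] -/
theorem exists_indexOfRecord_fst_eq (hemb : (InfinitePlace.mk ι₁).embedding = ι₁) (q : GramClass L) :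
    ∃ j : I V (repAt a₀) (muLiu ι₁ GramClass.rep), j.1 = q := by
  obtain ⟨μ₀, hμ₀, hw, hΦ⟩ := exists_isConjugateSymplectic_hasCMType (L := (L : Type))
    (lineType (repAt a₀ q).1 (repAt a₀ q).2.1 (repAt a₀ q).2.2)
  obtain ⟨j, hj, -⟩ := exists_line_eq_ofCM_chiSplittingLine_toHeckeCharacter V (repAt a₀) GramClass.rep (fun q => repAt_spec a₀ q)
    GramClass.mk_rep hemb (q := q) rfl μ₀ hμ₀ hw hΦ
  exact ⟨j, hj⟩

/-- **the index of record is non-empty** (gap (β) of the `hHom`-from-`hLiuC` derivation, route R-A: `hLiuC ∕ h411 ∕ hD1′` quantify `∀ i`,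
so ONE `i` is needed at every `(F, V, a₀)`; here it is, under E's `hemb`). [cite: Liu2021, Def. 4.12 (FJcycle.tex l. 2102–2111)] -/
theorem nonempty_indexOfRecord (hemb : (InfinitePlace.mk ι₁).embedding = ι₁) : Nonempty (I V (repAt a₀) (muLiu ι₁ GramClass.rep)) :=
  let ⟨j, _⟩ := exists_indexOfRecord_fst_eq V a₀ hemb (GramClass.mk a₀)
  ⟨j⟩

/-- **over the class of the pointing scalar the index line is Liu's `ι_{μ₀}` AT `a₀` ITSELF, on the nose**: for every conjugate-symplectic
weight-one `μ₀` with `Φ_{μ₀} = Φ^δ(a₀)` there is `j` over `GramClass.mk a₀` with `line … j = SplitLineE.ofCM V e₁ (vec a₀) … ι_{toHecke μ₀} …`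
(pin-3's pointed constructor at `repAt a₀ (mk a₀) = a₀`, `repAt_mk_self`) — so a consumer instantiating `hLiuC ∕ h411 ∕ hD1′` at this `j`
reads its rests at the scalar `a₀` (`repAt a₀ j.1 = a₀`). [cite: Liu2021, Def. 4.3, Def. 4.12 and Prop. 4.13 (FJcycle.tex l. 2102–2119)] -/
theorem exists_indexOfRecord_mk_line_eq (hemb : (InfinitePlace.mk ι₁).embedding = ι₁)
    (μ₀ : Literature.NumberTheory.Automorphic.IdeleClassGroup (L : Type) →ₜ* Circle) (hμ₀ : IsConjugateSymplectic (L : Type) μ₀) (hw : HasWeight (L : Type) μ₀ 1)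
    (hΦμ : HasCMType (L : Type) μ₀ (lineType a₀.1 a₀.2.1 a₀.2.2)) :
    ∃ j : I V (repAt a₀) (muLiu ι₁ GramClass.rep), j.1 = GramClass.mk a₀ ∧
      line V (repAt a₀) (muLiu ι₁ GramClass.rep) j =
        SplitLineE.ofCM V e₁ (RealScalar.vec a₀) (RealScalar.vec_real a₀) (RealScalar.vec_ne a₀)
          (chiSplittingLine (L : Type) e₁ (frameD V) (frameD_real V) (frameD_ne V) (toHeckeCharacter (L : Type) μ₀)
            (isUnitary_toHeckeCharacter (L : Type) μ₀) (isSplittingChar_toHeckeCharacter_of_isConjugateSymplectic (L : Type) μ₀ hμ₀)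
            (realDiagonal (L : Type) (RealScalar.vec a₀) (RealScalar.vec_real a₀))
            (isUnit_det_realDiagonal (L : Type) (RealScalar.vec a₀) (RealScalar.vec_real a₀) (RealScalar.vec_ne a₀))
            (Matrix.diagonal (RealScalar.vec a₀)) (realDiagonal_map (L : Type) (RealScalar.vec a₀) (RealScalar.vec_real a₀)).symm)
          (isCompatible_chiSplittingLine (L : Type) e₁ (frameD V) (frameD_real V) (frameD_ne V) (toHeckeCharacter (L : Type) μ₀)
            (isUnitary_toHeckeCharacter (L : Type) μ₀) (isSplittingChar_toHeckeCharacter_of_isConjugateSymplectic (L : Type) μ₀ hμ₀)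
            (realDiagonal (L : Type) (RealScalar.vec a₀) (RealScalar.vec_real a₀))
            (realDiagonal_isSymm (L : Type) (RealScalar.vec a₀) (RealScalar.vec_real a₀))
            (isUnit_det_realDiagonal (L : Type) (RealScalar.vec a₀) (RealScalar.vec_real a₀) (RealScalar.vec_ne a₀))
            (Matrix.diagonal (RealScalar.vec a₀)) (realDiagonal_map (L : Type) (RealScalar.vec a₀) (RealScalar.vec_real a₀)).symm) :=
  exists_line_eq_ofCM_chiSplittingLine_toHeckeCharacter V (repAt a₀) GramClass.rep (fun q => repAt_spec a₀ q) GramClass.mk_rep hemb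
    (repAt_mk_self a₀) μ₀ hμ₀ hw hΦμ

/-- the scalar the section of record assigns to such a `j` is `a₀` (so every rest `… (repAt a₀ j.1) …` of the END rows is the rest AT `a₀`).
[folklore] -/
theorem repAt_fst_eq_of_fst_eq_mk {j : I V (repAt a₀) (muLiu ι₁ GramClass.rep)} (hj : j.1 = GramClass.mk a₀) : repAt a₀ j.1 = a₀ := by
  rw [hj]
  exact repAt_mk_self a₀

end Summit.HodgeConjecture.CorCM.Transposition.CentralTypeAtPin

end
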